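import Summits.ValiantsHypothesis.ValiantsHypothesis.Theorems.DepthWindowNodeBias

/-!
# Route `DepthWindow` — two-letter words: the Euclid / continued-fraction bookkeeping of the builder

Cone-free helper (decomp-valiant lens 4, g15) supporting the crux item `HomImmHardTwoOne`
(stmt-ValiantsHypothesis-30635).  Pure arithmetic used by the universal low-bias-tree BUILDER for two-letter
words (`DepthWindowTwoLetterULB`): a word with letters `+s` and `-t` is aggregated along the CONVERGENT TYPES
`τ₀ = (-t)`, `τ₁ = (+s)`, `τ_{n+2} = a_n • τ_{n+1} + τ_n` (`a_n = ⌊ρ_n/ρ_{n+1}⌋`, `ρ_n` the Euclid remainders of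
`(t, s)`), whose values `e_n = (-1)^{n+1} ρ_n` shrink like a continued-fraction error.

* `rho`, `quo`, `ev` — remainders, partial quotients, signed values; `ev_add_two` (the recurrence),
  `rho_add_le` (strict decrease while positive);
* `cfL i n`, `cfR i n` — the coefficients of `τ_{i+n}` on the basis `(τ_i, τ_{i+1})` (continuants),
  `cost i n = cfL·ρ_i + cfR·ρ_{i+1}` = the `ℓ¹`-mass of a `τ_{i+n}`-node whose children are `τ_i`/`τ_{i+1}`-blocks;
  `ev_base` (values are linear), `cfL_ident` / `cfR_ident` (the continuant identities
  `cfL(n+1)ρ_{i+n} + cfL(n)ρ_{i+n+1} = ρ_{i+1}`, `cfR(n+1)ρ_{i+n} + cfR(n)ρ_{i+n+1} = ρ_i`), `cfL_le_cfR`,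
  `cfR_le`;
* `progress` — THE JUMP ESTIMATE: if `τ_{i+N+1}` is not affordable (`cost i (N+1) > β`) then
  `β·ρ_{i+N} ≤ 3·ρ_i·ρ_{i+1}`: the new small value is quadratically smaller (Fibonacci-type decay of the scale,
  hence `O(log log h)` rounds);
* `chain`, `chain_consume`, `chain_balance` — the COUNT CHAIN `(A, B) ↦ (B - a·A, A)` re-expressing the block
  counts on successive bases (exact, the basis change being unimodular), and its bookkeeping identities.

References: [BhargavDuttaSaxena2024] BDS 2024 §5 (the sequence `P_Δ` is the designed instance of this
bookkeeping); [LimayeSrinivasanTavenas2022] full version Def. 15.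
-/

-- layout Summits/ValiantsHypothesis/ValiantsHypothesis forces the duplicated namespace component
set_option linter.dupNamespace false

namespace Summit.ValiantsHypothesis.ValiantsHypothesis.Theorems.DepthWindow.TreeBias.TwoLetter

variable (t s : ℕ)

/-! ### Euclid remainders, quotients, signed values -/

/-- The Euclid pair after `n` steps from `(t, s)`: `(x, y) ↦ (y, x mod y)`. [folklore] -/
def euclidPair : ℕ → ℕ × ℕ
  | 0 => (t, s)
  | n + 1 => ((euclidPair n).2, (euclidPair n).1 % (euclidPair n).2)

/-- The remainder sequence `ρ₀ = t, ρ₁ = s, ρ_{n+2} = ρ_n mod ρ_{n+1}`. [folklore] -/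
def rho (n : ℕ) : ℕ := (euclidPair t s n).1

/-- `ρ₀ = t`. [folklore] -/
@[simp] theorem rho_zero : rho t s 0 = t := rfl

/-- `ρ₁ = s`. [folklore] -/
@[simp] theorem rho_one : rho t s 1 = s := rfl

/-- `ρ_{n+2} = ρ_n mod ρ_{n+1}`. [folklore] -/
theorem rho_add_two (n : ℕ) : rho t s (n + 2) = rho t s n % rho t s (n + 1) := rfl

/-- The partial quotients `a_n = ⌊ρ_n / ρ_{n+1}⌋`. [folklore] -/
def quo (n : ℕ) : ℕ := rho t s n / rho t s (n + 1)

/-- Euclid's division: `ρ_{n+1}·a_n + ρ_{n+2} = ρ_n`. [folklore] -/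
theorem rho_rec (n : ℕ) : rho t s (n + 1) * quo t s n + rho t s (n + 2) = rho t s n := by
  rw [rho_add_two, quo]; exact Nat.div_add_mod _ _

/-- `a_n ρ_{n+1} ≤ ρ_n`. [folklore] -/
theorem quo_mul_le (n : ℕ) : quo t s n * rho t s (n + 1) ≤ rho t s n := by
  rw [quo]; exact Nat.div_mul_le_self _ _

/-- Remainders decrease strictly while positive. [folklore] -/
theorem rho_add_two_lt (n : ℕ) (h : 0 < rho t s (n + 1)) : rho t s (n + 2) < rho t s (n + 1) := by
  rw [rho_add_two]; exact Nat.mod_lt _ h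

/-- `a_n ≥ 1` as soon as `0 < ρ_{n+1} ≤ ρ_n`. [folklore] -/
theorem one_le_quo (n : ℕ) (h1 : 0 < rho t s (n + 1)) (h2 : rho t s (n + 1) ≤ rho t s n) : 1 ≤ quo t s n :=
  (Nat.one_le_div_iff h1).2 h2

/-- From index `j ≥ 1` on, `i` consecutive positive remainders cost `i`: `ρ_{j+i} + i ≤ ρ_j`. [folklore] -/
theorem rho_add_le {j : ℕ} (hj : 1 ≤ j) :
    ∀ i : ℕ, (∀ m < i, 0 < rho t s (j + m)) → rho t s (j + i) + i ≤ rho t s j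
  | 0, _ => by simp
  | i + 1, h => by
    have ih := rho_add_le hj i fun m hm => h m (Nat.lt_succ_of_lt hm)
    have hpos := h i (Nat.lt_succ_self i)
    have hlt : rho t s (j + i - 1 + 2) < rho t s (j + i - 1 + 1) :=
      rho_add_two_lt t s (j + i - 1) (by rwa [show j + i - 1 + 1 = j + i by omega])
    rw [show j + i - 1 + 2 = j + (i + 1) by omega, show j + i - 1 + 1 = j + i by omega] at hlt
    omega

/-- Hence not all of `ρ_j, …, ρ_{j+ρ_j}` are positive (`j ≥ 1`). [folklore] -/
theorem not_all_pos {j : ℕ} (hj : 1 ≤ j) : ¬ ∀ m ≤ rho t s j, 0 < rho t s (j + m) := fun h => by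
  have := rho_add_le t s hj (rho t s j + 1) fun m hm => h m (Nat.le_of_lt_succ hm)
  omega

/-- All remainders are `≤ max t s`... in the form used: if `s ≤ t` then `ρ_n ≤ t` for every `n` reached through
positive remainders; we only need the first two and monotonicity, recorded as: `ρ_{n+1} ≤ ρ_n` for `n ≥ 1` when
`ρ_n > 0`. [folklore] -/
theorem rho_succ_le (n : ℕ) (hn : 1 ≤ n) (h : 0 < rho t s n) : rho t s (n + 1) ≤ rho t s n := by
  obtain ⟨m, rfl⟩ : ∃ m, n = m + 1 := ⟨n - 1, by omega⟩
  exact (rho_add_two_lt t s m h).le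

/-- The signed value of the type `τ_n`: `e_n = (-1)^{n+1} ρ_n` (`e₀ = -t`, `e₁ = +s`, alternating). [folklore] -/
def ev (n : ℕ) : ℤ := (-1) ^ (n + 1) * (rho t s n : ℤ)

/-- `e₀ = -t`. [folklore] -/
@[simp] theorem ev_zero : ev t s 0 = -(t : ℤ) := by simp [ev]

/-- `e₁ = s`. [folklore] -/
@[simp] theorem ev_one : ev t s 1 = (s : ℤ) := by simp [ev]

/-- `|e_n| = ρ_n`. [folklore] -/
theorem abs_ev (n : ℕ) : |ev t s n| = (rho t s n : ℤ) := by
  simp [ev, abs_mul, abs_pow]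

/-- The three-term recurrence `e_{n+2} = a_n e_{n+1} + e_n`. [folklore] -/
theorem ev_add_two (n : ℕ) : ev t s (n + 2) = (quo t s n : ℤ) * ev t s (n + 1) + ev t s n := by
  have h : (rho t s n : ℤ) = rho t s (n + 1) * quo t s n + rho t s (n + 2) := by
    exact_mod_cast (rho_rec t s n).symm
  simp only [ev]
  rw [h]
  ring

/-- `e_n = (-1)^{n+1} ρ_n` with the sign made explicit: `e_n = σ ρ_n`, `e_{n+1} = -σ ρ_{n+1}`, `σ = ±1`.
[folklore] -/
theorem ev_succ_eq_neg (n : ℕ) : ev t s (n + 1) = -((-1) ^ (n + 1) * (rho t s (n + 1) : ℤ)) := by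
  simp only [ev]; ring

/-! ### Continuants: the types `τ_{i+n}` on the basis `(τ_i, τ_{i+1})` -/

/-- Coefficient of `τ_i` in `τ_{i+n}`. [folklore] -/
def cfL (i : ℕ) : ℕ → ℕ
  | 0 => 1
  | 1 => 0
  | n + 2 => quo t s (i + n) * cfL i (n + 1) + cfL i n

/-- Coefficient of `τ_{i+1}` in `τ_{i+n}`. [folklore] -/
def cfR (i : ℕ) : ℕ → ℕ
  | 0 => 0
  | 1 => 1
  | n + 2 => quo t s (i + n) * cfR i (n + 1) + cfR i n

/-- `cfL 0 = 1`. [folklore] -/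
@[simp] theorem cfL_zero (i : ℕ) : cfL t s i 0 = 1 := rfl
/-- `cfL 1 = 0`. [folklore] -/
@[simp] theorem cfL_one (i : ℕ) : cfL t s i 1 = 0 := rfl
/-- Recurrence of `cfL`. [folklore] -/
theorem cfL_add_two (i n : ℕ) : cfL t s i (n + 2) = quo t s (i + n) * cfL t s i (n + 1) + cfL t s i n := rfl
/-- `cfR 0 = 0`. [folklore] -/
@[simp] theorem cfR_zero (i : ℕ) : cfR t s i 0 = 0 := rfl
/-- `cfR 1 = 1`. [folklore] -/
@[simp] theorem cfR_one (i : ℕ) : cfR t s i 1 = 1 := rfl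
/-- Recurrence of `cfR`. [folklore] -/
theorem cfR_add_two (i n : ℕ) : cfR t s i (n + 2) = quo t s (i + n) * cfR t s i (n + 1) + cfR t s i n := rfl

/-- The `ℓ¹`-mass of a `τ_{i+n}`-node whose children are `τ_i`- and `τ_{i+1}`-blocks. [folklore] -/
def cost (i n : ℕ) : ℕ := cfL t s i n * rho t s i + cfR t s i n * rho t s (i + 1)

/-- `cost 0 = ρ_i`. [folklore] -/
@[simp] theorem cost_zero (i : ℕ) : cost t s i 0 = rho t s i := by simp [cost]
/-- `cost 1 = ρ_{i+1}`. [folklore] -/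
@[simp] theorem cost_one (i : ℕ) : cost t s i 1 = rho t s (i + 1) := by simp [cost]
/-- The cost is linear in the type: same recurrence. [folklore] -/
theorem cost_add_two (i n : ℕ) : cost t s i (n + 2) = quo t s (i + n) * cost t s i (n + 1) + cost t s i n := by
  simp only [cost, cfL_add_two, cfR_add_two]; ring

/-- A type is never empty: `cfL n + cfR n ≥ 1`. [folklore] -/
theorem one_le_cfL_add_cfR (i : ℕ) : ∀ n, 1 ≤ cfL t s i n + cfR t s i n
  | 0 => by simp
  | 1 => by simp
  | n + 2 => by
    have := one_le_cfL_add_cfR i n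
    rw [cfL_add_two, cfR_add_two]; nlinarith

/-- **Values are linear**: `e_{i+n} = cfL(n)·e_i + cfR(n)·e_{i+1}`. [folklore] -/
theorem ev_base (i : ℕ) : ∀ n, ev t s (i + n) = (cfL t s i n : ℤ) * ev t s i + (cfR t s i n : ℤ) * ev t s (i + 1)
  | 0 => by simp
  | 1 => by simp
  | n + 2 => by
    rw [show i + (n + 2) = (i + n) + 2 by omega, ev_add_two, show i + n + 1 = i + (n + 1) by omega,
      ev_base i (n + 1), ev_base i n, cfL_add_two, cfR_add_two]
    push_cast; ring

/-- **Continuant identity (left)**: `cfL(n+1)·ρ_{i+n} + cfL(n)·ρ_{i+n+1} = ρ_{i+1}`. [folklore] -/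
theorem cfL_ident (i : ℕ) : ∀ n, cfL t s i (n + 1) * rho t s (i + n) + cfL t s i n * rho t s (i + n + 1) = rho t s (i + 1)
  | 0 => by simp
  | n + 1 => by
    have ih := cfL_ident i n
    have hr := rho_rec t s (i + n)
    rw [show i + (n + 1) + 1 = i + n + 2 by omega, show i + (n + 1) = i + n + 1 by omega,
      show n + 1 + 1 = n + 2 from rfl, cfL_add_two]
    rw [← ih, ← hr]; ring

/-- **Continuant identity (right)**: `cfR(n+1)·ρ_{i+n} + cfR(n)·ρ_{i+n+1} = ρ_i`. [folklore] -/
theorem cfR_ident (i : ℕ) : ∀ n, cfR t s i (n + 1) * rho t s (i + n) + cfR t s i n * rho t s (i + n + 1) = rho t s i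
  | 0 => by simp
  | n + 1 => by
    have ih := cfR_ident i n
    have hr := rho_rec t s (i + n)
    rw [show i + (n + 1) + 1 = i + n + 2 by omega, show i + (n + 1) = i + n + 1 by omega,
      show n + 1 + 1 = n + 2 from rfl, cfR_add_two]
    rw [← ih, ← hr]; ring

/-- `cfL ≤ cfR` from offset `1` on, as soon as `a_i ≥ 1`. [folklore] -/
theorem cfL_le_cfR (i : ℕ) (ha : 1 ≤ quo t s i) : ∀ n, 1 ≤ n → cfL t s i n ≤ cfR t s i n
  | 0, h => absurd h (by norm_num)
  | 1, _ => by simp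
  | 2, _ => by simp [cfL_add_two, cfR_add_two]; simpa using ha
  | n + 3, _ => by
    have h1 := cfL_le_cfR i ha (n + 1) (by omega)
    have h2 := cfL_le_cfR i ha (n + 2) (by omega)
    rw [show n + 3 = (n + 1) + 2 from rfl, cfL_add_two, cfR_add_two]
    exact Nat.add_le_add (Nat.mul_le_mul_left _ h2) h1

/-- `cfR ≤ (a_i + 1)·cfL` from offset `2` on, as soon as `a_{i+1} ≥ 1`. [folklore] -/
theorem cfR_le (i : ℕ) (ha : 1 ≤ quo t s (i + 1)) : ∀ n, 2 ≤ n → cfR t s i n ≤ (quo t s i + 1) * cfL t s i n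
  | 0, h | 1, h => absurd h (by norm_num)
  | 2, _ => by simp [cfL_add_two, cfR_add_two]
  | 3, _ => by
    simp only [show (3 : ℕ) = 1 + 2 from rfl, cfL_add_two, cfR_add_two, cfL_one, cfR_one, cfL_zero, cfR_zero]
    simp
    nlinarith
  | n + 4, _ => by
    have h1 := cfR_le i ha (n + 2) (by omega)
    have h2 := cfR_le i ha (n + 3) (by omega)
    rw [show n + 4 = (n + 2) + 2 from rfl, cfL_add_two, cfR_add_two, show n + 2 + 1 = n + 3 from rfl]
    nlinarith [Nat.zero_le (quo t s (i + (n + 2)))]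

/-- **The jump estimate.**  If `ρ_{i+1} ≤ ρ_i`, `a_{i+1} ≥ 1`, `N ≥ 2` and the type `τ_{i+N+1}` is NOT
affordable (`β < cost i (N+1)`), then `β·ρ_{i+N} ≤ 3·ρ_i·ρ_{i+1}`: after a maximal affordable jump the new small
value is quadratically smaller. [cite: BhargavDuttaSaxena2024, §5] -/
theorem progress (i N β : ℕ) (hle : rho t s (i + 1) ≤ rho t s i) (ha : 1 ≤ quo t s (i + 1)) (hN : 2 ≤ N)
    (hβ : β < cost t s i (N + 1)) : β * rho t s (i + N) ≤ 3 * rho t s i * rho t s (i + 1) := by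
  have hid := cfL_ident t s i N
  have hRL := cfR_le t s i ha (N + 1) (by omega)
  have hq := quo_mul_le t s i
  -- cost(N+1) ≤ 3·cfL(N+1)·ρ_i
  have hcost : cost t s i (N + 1) ≤ 3 * cfL t s i (N + 1) * rho t s i := by
    unfold cost
    have h1 : cfR t s i (N + 1) * rho t s (i + 1) ≤ (quo t s i + 1) * cfL t s i (N + 1) * rho t s (i + 1) :=
      Nat.mul_le_mul_right _ hRL
    have h2 : (quo t s i + 1) * rho t s (i + 1) ≤ rho t s i + rho t s (i + 1) := by nlinarith
    nlinarith
  -- cfL(N+1)·ρ_{i+N} ≤ ρ_{i+1}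
  have hL : cfL t s i (N + 1) * rho t s (i + N) ≤ rho t s (i + 1) := by
    have := hid; omega
  calc β * rho t s (i + N) ≤ 3 * cfL t s i (N + 1) * rho t s i * rho t s (i + N) :=
        Nat.mul_le_mul_right _ (le_trans hβ.le hcost)
    _ = 3 * rho t s i * (cfL t s i (N + 1) * rho t s (i + N)) := by ring
    _ ≤ 3 * rho t s i * rho t s (i + 1) := Nat.mul_le_mul_left _ hL

/-! ### The count chain -/

/-- The **count chain** from `(A, B)` (blocks of types `τ_i`, `τ_{i+1}`): after `m` steps the same letters read as
`(chain m).1` blocks of type `τ_{i+m}` and `(chain m).2` of type `τ_{i+m+1}` — `(A, B) ↦ (B - a_{i+m} A, A)`.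
[folklore] -/
def chain (i A B : ℕ) : ℕ → ℕ × ℕ
  | 0 => (A, B)
  | m + 1 => ((chain i A B m).2 - quo t s (i + m) * (chain i A B m).1, (chain i A B m).1)

/-- Step `0` of the chain. [folklore] -/
@[simp] theorem chain_zero (i A B : ℕ) : chain t s i A B 0 = (A, B) := rfl
/-- One step of the chain. [folklore] -/
theorem chain_succ (i A B m : ℕ) : chain t s i A B (m + 1) =
    ((chain t s i A B m).2 - quo t s (i + m) * (chain t s i A B m).1, (chain t s i A B m).1) := rfl

/-- **Exact consumption**: along a valid chain the blocks re-express the same letters —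
`A = C₁·cfL(m) + C₂·cfL(m+1)`, `B = C₁·cfR(m) + C₂·cfR(m+1)` with `(C₁, C₂) = chain m`. [folklore] -/
theorem chain_consume (i A B : ℕ) : ∀ m,
    (∀ m' < m, quo t s (i + m') * (chain t s i A B m').1 ≤ (chain t s i A B m').2) →
    A = (chain t s i A B m).1 * cfL t s i m + (chain t s i A B m).2 * cfL t s i (m + 1) ∧
    B = (chain t s i A B m).1 * cfR t s i m + (chain t s i A B m).2 * cfR t s i (m + 1)
  | 0, _ => by simp
  | m + 1, hv => by
    obtain ⟨hA, hB⟩ := chain_consume i A B m fun k hk => hv k (Nat.lt_succ_of_lt hk)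
    have hstep := hv m (Nat.lt_succ_self m)
    rw [chain_succ, show m + 1 + 1 = m + 2 from rfl, cfL_add_two, cfR_add_two]
    constructor
    · zify [hstep] at hA ⊢; linear_combination hA
    · zify [hstep] at hB ⊢; linear_combination hB

/-- **Balance is preserved** along a valid chain: `C₁·e_{i+m} + C₂·e_{i+m+1} = A·e_i + B·e_{i+1}`. [folklore] -/
theorem chain_balance (i A B m : ℕ)
    (hv : ∀ m' < m, quo t s (i + m') * (chain t s i A B m').1 ≤ (chain t s i A B m').2) :
    ((chain t s i A B m).1 : ℤ) * ev t s (i + m) + ((chain t s i A B m).2 : ℤ) * ev t s (i + m + 1) =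
      (A : ℤ) * ev t s i + (B : ℤ) * ev t s (i + 1) := by
  obtain ⟨hA, hB⟩ := chain_consume t s i A B m hv
  have hA' : (A : ℤ) = (((chain t s i A B m).1 * cfL t s i m + (chain t s i A B m).2 * cfL t s i (m + 1) : ℕ) : ℤ) := by
    exact_mod_cast hA
  have hB' : (B : ℤ) = (((chain t s i A B m).1 * cfR t s i m + (chain t s i A B m).2 * cfR t s i (m + 1) : ℕ) : ℤ) := by
    exact_mod_cast hB
  rw [ev_base t s i m, show i + m + 1 = i + (m + 1) by omega, ev_base t s i (m + 1), hA', hB']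
  push_cast; ring

end Summit.ValiantsHypothesis.ValiantsHypothesis.Theorems.DepthWindow.TreeBias.TwoLetter
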